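import Summits.ValiantsHypothesis.ValiantsHypothesis.Theorems.MonotoneRestorationOrbitRestorationQPValueDerivation
import Literature.Computability.AlgebraicComplexity.DawarWilsenach2025Proofs
import HarnessLib

/-!
# From a symmetric circuit to a value derivation of the same orbit width (symmetrisation in ORBIT currency, V)

Route MonotoneRestoration, crux `OrbitRestorationQP` (stmt-ValiantsHypothesis-18293), namespace
`Summit.ValiantsHypothesis.ValiantsHypothesis.Theorems.SymmetricValues`.

The CONVERSE of the value-orbit symmetrisation theorem (`…OrbitRestorationQPValueOrbit.lean`): the values
of the gates of a `Γ`-symmetric Dawar–Wilsenach circuit `C` (Def. 2.2/3.7: SET-children, sums and products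
of ANY fan-in) form — after binarising the products — a value derivation (`…ValueDerivation.lean`: weighted
sums of any fan-in, BINARY products) all of whose values have `Γ`-orbits of size `≤ ORB(C)`.  Products
`Π_{h ∈ children g} v_h` of unbounded fan-in are binarised WITHOUT enlarging value orbits by NEWTON'S
IDENTITIES: the derivation passes through the powers `v_h^j`, the power sums `P_j = Σ_h v_h^j`, the
elementary symmetric values `E_k` of the children values and the products `E_{k-i} · P_i`
(`k E_k = Σ_{i=1}^{k} (-1)^{i-1} E_{k-i} P_i`, characteristic `0`) — every one of them a function of the
children SET of `g` (or of one child), hence moved by automorphisms exactly like `g` (or the child).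

This file: heights, the Newton data `chE`/`chP` with the recurrence (`chE_newton`, from Mathlib's
`MvPolynomial.mul_esymm_eq_sum`), the NAMES of the derivation (`Nm`: gates, powers, power sums, Newton
products, elementary symmetric values) with their values `nval`, ranks `nrank` and steps `recipe`, and the two
structural facts `recipe_value` (each step computes the named value) and `recipe_args` (its operands are
named values of smaller rank).  The sequel `…ValueOrbitIff.lean` bounds the orbits and assembles the
derivation.  Everything is proved. [folklore]

## References
* A. Dawar, G. Wilsenach, *Symmetric arithmetic circuits*, ToC 21 (2025), Defs. 2.2, 3.6, 3.7, §3.3.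
  [DawarWilsenach2025]
-/

noncomputable section

open scoped Classical

-- `Summit.ValiantsHypothesis.ValiantsHypothesis.…` is the tree's single-conjunct layout (Sub = Summit).
set_option linter.dupNamespace false

namespace Summit.ValiantsHypothesis.ValiantsHypothesis.Theorems

universe u v w

namespace SymmetricValues

open Literature.Computability.AlgebraicComplexity LabelledArithCircuit Finset

variable {K : Type u} {X : Type v} {G : Type w} [Field K] (C : LabelledArithCircuit K X Unit G)

/-! ### Heights -/

/-- The height of a gate (`1 +` the maximal height of a child). [folklore] -/
def ht : G → ℕ := C.wf.fix fun g rec => (C.children g).attach.sup (fun h => rec h.1 h.2) + 1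

omit [Field K] in
/-- The height equation. [folklore] -/
theorem ht_eq (g : G) : ht C g = (C.children g).sup (ht C) + 1 := by
  conv_lhs => rw [ht, WellFounded.fix_eq]
  exact congrArg (· + 1) (Finset.sup_attach (C.children g) (ht C))

omit [Field K] in
/-- Children are lower. [folklore] -/
theorem ht_lt_of_mem {g h : G} (hh : h ∈ C.children g) : ht C h < ht C g := by
  rw [ht_eq C g]
  exact Nat.lt_succ_of_le (Finset.le_sup (f := ht C) hh)

omit [Field K] in
/-- Heights are positive. [folklore] -/
theorem one_le_ht (g : G) : 1 ≤ ht C g := by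
  rw [ht_eq C g]; exact Nat.le_add_left 1 _

/-! ### Newton data at a gate -/

/-- `E_k(g)`: the `k`-th elementary symmetric function of the multiset of children values of `g`. [folklore] -/
def chE (g : G) (k : ℕ) : MvPolynomial X K := ((C.children g).val.map C.eval).esymm k

/-- `P_j(g)`: the `j`-th power sum of the children values of `g`. [folklore] -/
def chP (g : G) (j : ℕ) : MvPolynomial X K := ∑ h ∈ C.children g, C.eval h ^ j

/-- `E_0 = 1`. [folklore] -/
theorem chE_zero (g : G) : chE C g 0 = 1 := by
  simp [chE, Multiset.esymm, Multiset.powersetCard_zero_left]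

/-- `E_{|children|} = Π children values`. [folklore] -/
theorem chE_card (g : G) : chE C g (C.children g).card = ∏ h ∈ C.children g, C.eval h := by
  rw [chE, Finset.esymm_map_val, Finset.powersetCard_self, Finset.sum_singleton]

/-- The Newton coefficient of the term `E_{a.1} P_{a.2}` in `E_k`. [folklore] -/
def newtonCoef (k : ℕ) (a : ℕ × ℕ) : K := (-1) ^ (k + 1 + a.1) * ((k : K)⁻¹)

/-- The index pairs of Newton's identity for `E_k`: `a.1 + a.2 = k`, `a.1 < k`. [folklore] -/
def newtonIdx (k : ℕ) : Finset (ℕ × ℕ) := (antidiagonal k).filter fun a => a.1 < k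

/-- **Newton's identity for the children values** (characteristic `0`, `k ≥ 1`):
`E_k = Σ_{a.1 + a.2 = k, a.1 < k} (-1)^{k+1+a.1} k⁻¹ · E_{a.1} P_{a.2}`. [folklore] -/
theorem chE_newton [CharZero K] (g : G) {k : ℕ} (hk : 1 ≤ k) :
    chE C g k = ∑ a ∈ newtonIdx k, MvPolynomial.C (newtonCoef (K := K) k a) * (chE C g a.1 * chP C g a.2) := by
  -- transport Mathlib's identity along `aeval`
  set σ := ↥(C.children g)
  let φ : σ → MvPolynomial X K := fun h => C.eval h.1
  have hE : ∀ j, MvPolynomial.aeval φ (MvPolynomial.esymm σ K j) = chE C g j := by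
    intro j
    rw [MvPolynomial.aeval_esymm_eq_multiset_esymm, chE]
    congr 1
    rw [Finset.univ_eq_attach, Finset.attach_val]
    exact Multiset.attach_map_val' _ _
  have hP : ∀ j, MvPolynomial.aeval φ (MvPolynomial.psum σ K j) = chP C g j := by
    intro j
    simp only [MvPolynomial.psum, map_sum, map_pow, MvPolynomial.aeval_X, chP, φ]
    exact Finset.sum_coe_sort (C.children g) (fun h => C.eval h ^ j)
  have H := congrArg (MvPolynomial.aeval φ) (MvPolynomial.mul_esymm_eq_sum σ K k)
  simp only [map_mul, map_natCast, map_sum, map_pow, map_neg, map_one, hE, hP] at H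
  -- divide by `k`
  have hk0 : (k : K) ≠ 0 := Nat.cast_ne_zero.2 (by omega)
  have hCk : (k : MvPolynomial X K) = MvPolynomial.C (k : K) := (map_natCast MvPolynomial.C k).symm
  have : chE C g k = MvPolynomial.C ((k : K)⁻¹) * ((k : MvPolynomial X K) * chE C g k) := by
    rw [hCk, ← mul_assoc, ← map_mul, inv_mul_cancel₀ hk0, map_one, one_mul]
  rw [this, H, newtonIdx, Finset.mul_sum, Finset.mul_sum]
  refine Finset.sum_congr rfl fun a _ => ?_
  simp only [newtonCoef, map_mul, map_pow, map_neg, map_one, pow_add]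
  ring

/-! ### Names, values, ranks, recipes -/

/-- The NAMES of the values of the derivation: gates, powers of gate values, power sums, Newton
products and elementary symmetric values of children. [folklore] -/
inductive Nm (G : Type w) : Type w
  /-- The value of gate `g`. -/
  | gate (g : G) : Nm G
  /-- The power `v_h^j`. -/
  | pw (h : G) (j : ℕ) : Nm G
  /-- The power sum `P_j(g)`. -/
  | ps (g : G) (j : ℕ) : Nm G
  /-- The Newton product `E_{a.1}(g) · P_{a.2}(g)`. -/
  | nt (g : G) (a : ℕ × ℕ) : Nm G
  /-- The elementary symmetric value `E_k(g)`. -/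
  | es (g : G) (k : ℕ) : Nm G

/-- The value of a name. [folklore] -/
def nval : Nm G → MvPolynomial X K
  | Nm.gate g => C.eval g
  | Nm.pw h j => C.eval h ^ j
  | Nm.ps g j => chP C g j
  | Nm.nt g a => chE C g a.1 * chP C g a.2
  | Nm.es g k => chE C g k

variable [Fintype G]

/-- The size bound `M₀ = |G|` (bounds every fan-in and every Newton index). [folklore] -/
def M₀ (_C : LabelledArithCircuit K X Unit G) : ℕ := Fintype.card G

/-- The rank scale `A = 4 M₀ + 8`. [folklore] -/
def A : ℕ := 4 * M₀ C + 8

/-- The rank of a name. [folklore] -/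
def nrank : Nm G → ℕ
  | Nm.gate g => A C * ht C g
  | Nm.pw h j => A C * ht C h + j
  | Nm.ps g j => A C * (ht C g - 1) + M₀ C + 1 + j
  | Nm.nt g a => A C * (ht C g - 1) + 2 * M₀ C + 1 + 2 * (a.1 + a.2)
  | Nm.es g k => A C * (ht C g - 1) + 2 * M₀ C + 2 + 2 * k

/-- The step for `E_k(g)`: the constant `1` for `k = 0`, Newton's identity otherwise. [folklore] -/
def esRecipe (g : G) (k : ℕ) : StepData K X :=
  if k = 0 then StepData.const 1
  else StepData.sum ((newtonIdx k).val.map fun a => (newtonCoef k a, chE C g a.1 * chP C g a.2))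

/-- The step of a name. [folklore] -/
def recipe : Nm G → StepData K X
  | Nm.gate g =>
    match C.label g with
    | .var x => StepData.var x
    | .const c => StepData.const c
    | .add => StepData.sum ((C.children g).val.map fun h => (1, C.eval h))
    | .mul => esRecipe C g (C.children g).card
  | Nm.pw h j => if j = 0 then StepData.const 1 else StepData.prod (C.eval h ^ (j - 1)) (C.eval h)
  | Nm.ps g j => StepData.sum ((C.children g).val.map fun h => (1, C.eval h ^ j))
  | Nm.nt g a => StepData.prod (chE C g a.1) (chP C g a.2)
  | Nm.es g k => esRecipe C g k

/-- The Newton index pairs used: `a ∈ newtonIdx k`, `1 ≤ k ≤ M₀`. [folklore] -/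
def ntIdx : Finset (ℕ × ℕ) := (Icc 1 (M₀ C)).biUnion newtonIdx

/-- **The finite set of names used.** [folklore] -/
def names : Finset (Nm G) :=
  univ.image Nm.gate ∪ (univ ×ˢ Icc 2 (M₀ C)).image (fun p => Nm.pw p.1 p.2) ∪
    (univ ×ˢ Icc 1 (M₀ C)).image (fun p => Nm.ps p.1 p.2) ∪
    (univ ×ˢ ntIdx C).image (fun p => Nm.nt p.1 p.2) ∪
    (univ ×ˢ range (M₀ C + 1)).image (fun p => Nm.es p.1 p.2)

omit [Field K] in
/-- Fan-ins are at most `M₀`. [folklore] -/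
theorem card_children_le (g : G) : (C.children g).card ≤ M₀ C := Finset.card_le_univ _

omit [Field K] [Fintype G] in
/-- A multiplication gate has a child. [folklore] -/
theorem one_le_card_children_of_mul {g : G} (hg : C.label g = .mul) : 1 ≤ (C.children g).card := by
  rw [Nat.one_le_iff_ne_zero, Ne, Finset.card_eq_zero]
  intro h0
  have := (C.isInput_iff g).2 h0
  rw [hg] at this
  exact this

omit [Field K] in
/-- Gates are names. [folklore] -/
theorem gate_mem_names (g : G) : Nm.gate g ∈ names C :=
  mem_union_left _ (mem_union_left _ (mem_union_left _ (mem_union_left _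
    (mem_image.2 ⟨g, mem_univ g, rfl⟩))))

omit [Field K] in
/-- Powers with exponent `2 ≤ j ≤ M₀` are names. [folklore] -/
theorem pw_mem_names {h : G} {j : ℕ} (h2 : 2 ≤ j) (hM : j ≤ M₀ C) : Nm.pw h j ∈ names C :=
  mem_union_left _ (mem_union_left _ (mem_union_left _ (mem_union_right _
    (mem_image.2 ⟨(h, j), mem_product.2 ⟨mem_univ h, mem_Icc.2 ⟨h2, hM⟩⟩, rfl⟩))))

omit [Field K] in
/-- Power sums with `1 ≤ j ≤ M₀` are names. [folklore] -/
theorem ps_mem_names {g : G} {j : ℕ} (h1 : 1 ≤ j) (hM : j ≤ M₀ C) : Nm.ps g j ∈ names C :=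
  mem_union_left _ (mem_union_left _ (mem_union_right _
    (mem_image.2 ⟨(g, j), mem_product.2 ⟨mem_univ g, mem_Icc.2 ⟨h1, hM⟩⟩, rfl⟩)))

omit [Field K] in
/-- Newton products with admissible indices are names. [folklore] -/
theorem nt_mem_names {g : G} {k : ℕ} {a : ℕ × ℕ} (h1 : 1 ≤ k) (hM : k ≤ M₀ C) (ha : a ∈ newtonIdx k) :
    Nm.nt g a ∈ names C :=
  mem_union_left _ (mem_union_right _
    (mem_image.2 ⟨(g, a), mem_product.2 ⟨mem_univ g, mem_biUnion.2 ⟨k, mem_Icc.2 ⟨h1, hM⟩, ha⟩⟩, rfl⟩))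

omit [Field K] in
/-- Elementary symmetric values with `k ≤ M₀` are names. [folklore] -/
theorem es_mem_names {g : G} {k : ℕ} (hM : k ≤ M₀ C) : Nm.es g k ∈ names C :=
  mem_union_right _ (mem_image.2 ⟨(g, k), mem_product.2 ⟨mem_univ g, mem_range.2 (by omega)⟩, rfl⟩)

omit [Field K] in
/-- The parameters of a name in `names`: exponents of powers. [folklore] -/
theorem bounds_of_pw_mem {h : G} {j : ℕ} (hν : Nm.pw h j ∈ names C) : 2 ≤ j ∧ j ≤ M₀ C := by
  simp only [names, mem_union, mem_image, mem_product, mem_univ, true_and, mem_Icc, Nm.pw.injEq,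
    reduceCtorEq, and_false, exists_false, or_false, false_or] at hν
  obtain ⟨p, hp, -, rfl⟩ := hν
  exact hp

omit [Field K] in
/-- The parameters of a name in `names`: indices of power sums. [folklore] -/
theorem bounds_of_ps_mem {g : G} {j : ℕ} (hν : Nm.ps g j ∈ names C) : 1 ≤ j ∧ j ≤ M₀ C := by
  simp only [names, mem_union, mem_image, mem_product, mem_univ, true_and, mem_Icc, Nm.ps.injEq,
    reduceCtorEq, and_false, exists_false, or_false, false_or] at hν
  obtain ⟨p, hp, -, rfl⟩ := hν
  exact hp

omit [Field K] in
/-- The parameters of a name in `names`: Newton indices. [folklore] -/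
theorem idx_of_nt_mem {g : G} {a : ℕ × ℕ} (hν : Nm.nt g a ∈ names C) :
    ∃ k, 1 ≤ k ∧ k ≤ M₀ C ∧ a ∈ newtonIdx k := by
  simp only [names, mem_union, mem_image, mem_product, mem_univ, true_and, Nm.nt.injEq,
    reduceCtorEq, and_false, exists_false, or_false, false_or] at hν
  obtain ⟨p, hp, -, rfl⟩ := hν
  obtain ⟨k, hk, ha⟩ := mem_biUnion.1 hp
  exact ⟨k, (mem_Icc.1 hk).1, (mem_Icc.1 hk).2, ha⟩

omit [Field K] in
/-- The parameters of a name in `names`: elementary symmetric indices. [folklore] -/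
theorem bound_of_es_mem {g : G} {k : ℕ} (hν : Nm.es g k ∈ names C) : k ≤ M₀ C := by
  simp only [names, mem_union, mem_image, mem_product, mem_univ, true_and, mem_range, Nm.es.injEq,
    reduceCtorEq, and_false, exists_false, or_false, false_or] at hν
  obtain ⟨p, hp, -, rfl⟩ := hν
  omega

/-- Membership in `newtonIdx`. [folklore] -/
theorem mem_newtonIdx {k : ℕ} {a : ℕ × ℕ} : a ∈ newtonIdx k ↔ a.1 + a.2 = k ∧ a.1 < k := by
  simp [newtonIdx, HasAntidiagonal.mem_antidiagonal]

/-! ### Each step computes the named value -/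

omit [Fintype G] in
/-- The value of the Newton step. [folklore] -/
theorem esRecipe_value [CharZero K] (g : G) (k : ℕ) : (esRecipe C g k).value = chE C g k := by
  unfold esRecipe
  split_ifs with hk
  · subst hk; simp [StepData.value, chE_zero]
  · simp only [StepData.value, Multiset.map_map, Function.comp_def]
    rw [chE_newton C g (Nat.one_le_iff_ne_zero.2 hk), Finset.sum_eq_multiset_sum]

/-- **Every name's step computes its value.** [folklore] -/
theorem recipe_value [CharZero K] (ν : Nm G) (hν : ν ∈ names C) : (recipe C ν).value = nval C ν := by
  cases ν with
  | gate g =>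
    show (recipe C (Nm.gate g)).value = C.eval g
    rcases hl : C.label g with x | c | _ | _ <;> simp only [recipe, hl]
    · simp only [StepData.value]; exact (C.eval_of_label_var hl).symm
    · simp only [StepData.value]; exact (C.eval_of_label_const hl).symm
    · simp only [StepData.value, Multiset.map_map, Function.comp_def, map_one, one_mul]
      rw [C.eval_of_label_add hl, Finset.sum_eq_multiset_sum]
    · rw [esRecipe_value, chE_card, C.eval_of_label_mul hl]
  | pw h j =>
    obtain ⟨h2, -⟩ := bounds_of_pw_mem C hν
    simp only [recipe, nval, if_neg (show j ≠ 0 by omega), StepData.value]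
    rw [← pow_succ, Nat.sub_add_cancel (by omega)]
  | ps g j =>
    simp only [recipe, nval, StepData.value, Multiset.map_map, Function.comp_def, map_one, one_mul, chP]
    rw [Finset.sum_eq_multiset_sum]
  | nt g a => simp [recipe, nval, StepData.value]
  | es g k => simp only [recipe, nval]; exact esRecipe_value C g k

/-! ### The operands of each step are named values of smaller rank -/

omit [Field K] in
/-- `A > 4 M₀ + 1`. [folklore] -/
theorem A_gt : 4 * M₀ C + 1 < A C := by unfold A; omega

omit [Fintype G] in
/-- Operands of the Newton step for `E_k(g)`, `1 ≤ k`. [folklore] -/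
theorem esRecipe_args {g : G} {k : ℕ} (h1 : 1 ≤ k) {u : MvPolynomial X K}
    (hu : u ∈ (esRecipe C g k).args) :
    ∃ a ∈ newtonIdx k, u = nval C (Nm.nt g a) := by
  unfold esRecipe at hu
  rw [if_neg (by omega)] at hu
  simp only [StepData.args, Multiset.map_map, Function.comp_def, Multiset.mem_map, Finset.mem_val] at hu
  obtain ⟨a, ha, rfl⟩ := hu
  exact ⟨a, ha, rfl⟩

/-- **Every operand of a name's step is the value of a name of smaller rank.** [folklore] -/
theorem recipe_args (ν : Nm G) (hν : ν ∈ names C) {u : MvPolynomial X K} (hu : u ∈ (recipe C ν).args) :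
    ∃ μ ∈ names C, nval C μ = u ∧ nrank C μ < nrank C ν := by
  have hA := A_gt C
  cases ν with
  | gate g =>
    simp only [recipe] at hu
    rcases hl : C.label g with x | c | _ | _ <;> rw [hl] at hu
    · simp [StepData.args] at hu
    · simp [StepData.args] at hu
    · simp only [StepData.args, Multiset.map_map, Function.comp_def, Multiset.mem_map, Finset.mem_val] at hu
      obtain ⟨h, hh, rfl⟩ := hu
      refine ⟨Nm.gate h, gate_mem_names C h, rfl, ?_⟩
      simp only [nrank]
      exact Nat.mul_lt_mul_of_pos_left (ht_lt_of_mem C hh) (by omega)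
    · have hm1 := one_le_card_children_of_mul C hl
      have hmM := card_children_le C g
      obtain ⟨a, ha, rfl⟩ := esRecipe_args C hm1 hu
      refine ⟨Nm.nt g a, nt_mem_names C hm1 hmM ha, rfl, ?_⟩
      have hak := (mem_newtonIdx.1 ha).1
      simp only [nrank]
      have h1 := one_le_ht C g
      have : A C * (ht C g - 1) + A C = A C * ht C g := by
        rw [← Nat.mul_succ, Nat.succ_eq_add_one, Nat.sub_add_cancel h1]
      omega
  | pw h j =>
    obtain ⟨h2, hM⟩ := bounds_of_pw_mem C hν
    simp only [recipe, if_neg (show j ≠ 0 by omega), StepData.args, Multiset.insert_eq_cons,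
      Multiset.mem_cons, Multiset.mem_singleton] at hu
    rcases hu with rfl | rfl
    · by_cases hj : j = 2
      · subst hj
        refine ⟨Nm.gate h, gate_mem_names C h, by simp [nval], ?_⟩
        simp [nrank]
      · refine ⟨Nm.pw h (j - 1), pw_mem_names C (by omega) (by omega), rfl, ?_⟩
        simp only [nrank]; omega
    · refine ⟨Nm.gate h, gate_mem_names C h, rfl, ?_⟩
      simp only [nrank]; omega
  | ps g j =>
    obtain ⟨h1, hM⟩ := bounds_of_ps_mem C hν
    simp only [recipe, StepData.args, Multiset.map_map, Function.comp_def, Multiset.mem_map,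
      Finset.mem_val] at hu
    obtain ⟨h, hh, rfl⟩ := hu
    have hlt := ht_lt_of_mem C hh
    have hle : A C * ht C h + j ≤ A C * (ht C g - 1) + M₀ C := by
      have : ht C h ≤ ht C g - 1 := by omega
      have := Nat.mul_le_mul_left (A C) this
      omega
    by_cases hj : j = 1
    · subst hj
      refine ⟨Nm.gate h, gate_mem_names C h, by simp [nval], ?_⟩
      simp only [nrank]; omega
    · refine ⟨Nm.pw h j, pw_mem_names C (by omega) hM, rfl, ?_⟩
      simp only [nrank]; omega
  | nt g a =>
    obtain ⟨k, hk1, hkM, ha⟩ := idx_of_nt_mem C hν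
    obtain ⟨hsum, hlt⟩ := mem_newtonIdx.1 ha
    simp only [recipe, StepData.args, Multiset.insert_eq_cons, Multiset.mem_cons, Multiset.mem_singleton] at hu
    rcases hu with rfl | rfl
    · refine ⟨Nm.es g a.1, es_mem_names C (by omega), rfl, ?_⟩
      simp only [nrank]; omega
    · refine ⟨Nm.ps g a.2, ps_mem_names C (by omega) (by omega), rfl, ?_⟩
      simp only [nrank]; omega
  | es g k =>
    have hk := bound_of_es_mem C hν
    simp only [recipe] at hu
    by_cases hk0 : k = 0
    · subst hk0; simp [esRecipe, StepData.args] at hu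
    · obtain ⟨a, ha, rfl⟩ := esRecipe_args C (Nat.one_le_iff_ne_zero.2 hk0) hu
      refine ⟨Nm.nt g a, nt_mem_names C (Nat.one_le_iff_ne_zero.2 hk0) hk ha, rfl, ?_⟩
      have := (mem_newtonIdx.1 ha).1
      simp only [nrank]; omega

end SymmetricValues

end Summit.ValiantsHypothesis.ValiantsHypothesis.Theorems

end
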